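import Summits.BirchSwinnertonDyer.BirchSwinnertonDyer.Theorems.AdditiveKolyvaginRoadRamifiedHabitatSignLawField
import HarnessLib

/-!
# Route `AdditiveKolyvaginRoad`, crux KS′ `LevelKolyvaginSystemsAdditive` (stmt-BirchSwinnertonDyer-21396), card `ramified-toric-habitat` —
# the `p`-UNRAMIFIED habitat never has sign `+1`: why the card lets `p` ramify (PART A, column 4, as a theorem)

Cell `pub/bsd-wall`, width seat `bsd-wall-akr-p2x-w2` g12; `--supports stmt-BirchSwinnertonDyer-21396` (helper). THEOREMS ONLY; no definition,
no named fact, no `sorry`. BSD is not proved by any of this; KS′/KPA′ stay OPEN at `p² ∣ N`.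

The card's motivation (ii) and PART A column 4 («`p` inert & all other bad primes split ⟹ `w(E)·w(E^{(d)}) = −1` ALWAYS»): if the auxiliary
imaginary quadratic field is UNRAMIFIED at the additive prime `p` (`p ∤ d`) and every other bad prime splits, then — whatever the Kodaira type
at `p`, whatever `w(E)`, and whether `p` is split or inert — `w(E)·w(E^{(d)}) = −1`, because `v_p(N) = 2` is EVEN: by the coprime twist law
`w(E^{(d)}) = (−1/|d|)·(N/|d|)·w(E)` (Murty–Murty Ch. 6 §1, tree theorem `rootNumber_quadraticTwist_of_emod_four_eq_one`) with
`(N/|d|) = (M/|d|)·(p/|d|)² = (M/|d|) = ∏_{q ∣ M} (d/q)^{v_q(M)} = 1` and `(−1/|d|) = −1`. So the analytic-rank-`0` rows (`w(E) = +1`, among them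
the twists `E^{(d_K)}` with no multiplicative prime) have NO `χ = 1` definite habitat with `p` unramified — the sign obstruction that the
`p`-RAMIFIED habitat of the card removes (`…SignLawAnyLevelSketch`: there the sign is `+1` on the supercuspidal rows). Assuming ONLY the
Modularity Theorem; `E` with ARBITRARY reduction away from `p`.

* `jacobiSym_natCast_natAbs_eq_one_of_split` — `(M/|d|) = 1` for any `M ≠ 0` all of whose primes split in `ℚ(√d)` (`d ≡ 1 (4)`).
* `rootNumber_mul_rootNumber_twist_eq_neg_one_of_unramified` — `N = M·p²`, `d ≡ 1 (4)` squarefree negative, `(d, N) = 1`, every prime of `M`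
  split ⟹ `w(E)·w(E^{(d)}) = −1`.
* `rootNumber_mul_rootNumber_twist_discr_eq_neg_one_of_unramified` — field form: `K′` imaginary quadratic with odd `d_{K′}`, `p ∤ d_{K′}`, every
  prime of `M` split.

References: [cite: MurtyMurty1997, Ch. 6 §1] [cite: SilvermanAEC2009, X.2 and App. C §16].
-/

set_option autoImplicit false
set_option linter.dupNamespace false

noncomputable section

open scoped Classical MatrixGroups NumberTheorySymbols

open CongruenceSubgroup IsDedekindDomain IsDedekindDomain.HeightOneSpectrum NumberField Rat.HeightOneSpectrum
  WeierstrassCurve Literature.NumberTheory.EllipticCurves Literature.NumberTheory.EllipticCurves.ModularForms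
  IsDiscreteValuationRing

namespace Summit.BirchSwinnertonDyer.BirchSwinnertonDyer.Theorems.AdditiveKoly.RamifiedHabitat

section Unramified

variable {p : ℕ} [Fact p.Prime]

/-- `(M / |d|) = 1` for ANY `M ≠ 0` all of whose primes split in `ℚ(√d)` (`d ≡ 1 (mod 4)`; `(d/q) = 1` at odd `q ∣ M`, `d ≡ 1 (mod 8)` if
`2 ∣ M`): prime by prime on `M = ∏ q^{v_q(M)}` with `(q/|d|) = (d/q)` (Jacobi reciprocity for `d ≡ 1 (4)`, the tree's
`jacobiSym_natAbs_eq_of_emod_four_eq_one`) and `(2/|d|) = 1 ⟺ d ≡ 1 (8)`. [folklore] -/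
theorem jacobiSym_natCast_natAbs_eq_one_of_split {d : ℤ} (hd4 : d % 4 = 1) {M : ℕ} (hM0 : M ≠ 0)
    (hodd : ∀ q ∈ M.primeFactors, q ≠ 2 → J(d | q) = 1) (htwo : 2 ∣ M → d % 8 = 1) :
    J((M : ℤ) | d.natAbs) = 1 := by
  let φ : ℤ →* ℤ :=
    { toFun := fun a ↦ jacobiSym a d.natAbs
      map_one' := jacobiSym.one_left _
      map_mul' := fun a b ↦ jacobiSym.mul_left a b _ }
  have hφ : ∀ a : ℤ, φ a = J(a | d.natAbs) := fun _ ↦ rfl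
  conv_lhs => rw [Nat.prod_primeFactors_pow_factorization hM0, Nat.cast_prod, ← hφ, map_prod]
  refine Finset.prod_eq_one fun q hq ↦ ?_
  rw [Nat.cast_pow, map_pow, hφ]
  have hqP : q.Prime := Nat.prime_of_mem_primeFactors hq
  by_cases hq2 : q = 2
  · subst hq2
    rw [Nat.cast_ofNat,
      (Literature.NumberTheory.QuadraticFields.jacobiSym_two_natAbs_eq_one_iff hd4).mpr (htwo (Nat.dvd_of_mem_primeFactors hq)), one_pow]
  · rw [Literature.NumberTheory.QuadraticFields.jacobiSym_natAbs_eq_of_emod_four_eq_one hd4 (hqP.odd_of_ne_two hq2), hodd q hq hq2,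
      one_pow]

/-- `(−1 / |d|) = −1` for `d ≡ 1 (mod 4)` negative (`|d| ≡ 3 (mod 4)`). [folklore] -/
theorem jacobiSym_neg_one_natAbs_eq_neg_one_of_neg {d : ℤ} (hd4 : d % 4 = 1) (hneg : d < 0) : J(-1 | d.natAbs) = -1 := by
  have hodd : Odd d.natAbs := Int.natAbs_odd.mpr (Int.odd_iff.mpr (by omega))
  rw [jacobiSym.at_neg_one hodd, ZMod.χ₄_nat_eq_if_mod_four]
  have h1 : (d.natAbs : ℤ) = -d := Int.ofNat_natAbs_of_nonpos hneg.le
  have h2 : d.natAbs % 4 = 3 := by omega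
  have h3 : d.natAbs % 2 = 1 := by omega
  simp [h2, h3]

omit [Fact p.Prime] in
/-- **THE `p`-UNRAMIFIED HABITAT HAS SIGN `−1`, ALWAYS** (card PART A col. 4; assuming only the Modularity Theorem). `W/ℚ` elliptic of
conductor `N = M·p²` (NO hypothesis on `M` or on the type at `p` beyond `v_p(N) = 2`), `d ≡ 1 (4)` squarefree, `d < 0`, `(d, N) = 1` (so `p` and
all bad primes are unramified in `ℚ(√d)`; `p` may be split OR inert), every prime of `M` split. Then `w(E)·w(E^{(d)}) = −1` — whatever `w(E)`
is: `w(E^{(d)}) = (−1/|d|)(N/|d|) w(E)` with `(N/|d|) = (M/|d|)(p/|d|)² = 1`. Hence no `χ = 1` DEFINITE habitat unramified at `p` exists for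
an analytic-rank-`0` row. [cite: MurtyMurty1997, Ch. 6 §1] -/
theorem rootNumber_mul_rootNumber_twist_eq_neg_one_of_unramified (W : WeierstrassCurve ℚ) [W.IsElliptic] (hmod : exists_isNewformOf)
    {M : ℕ} (hN : W.conductorNorm ℤ = M * p ^ 2)
    {d : ℤ} (hd4 : d % 4 = 1) (hdsq : Squarefree d) (hneg : d < 0) (hgcd : Int.gcd d (W.conductorNorm ℤ) = 1)
    (hodd : ∀ q ∈ M.primeFactors, q ≠ 2 → J(d | q) = 1) (htwo : 2 ∣ M → d % 8 = 1) :
    W.rootNumber * (W.quadraticTwist (d : ℚ)).rootNumber = -1 := by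
  have hM0 : M ≠ 0 := by
    intro h; rw [h, zero_mul] at hN; exact (W.conductorNorm_pos_holds).ne' hN
  have hd0 : d ≠ 0 := by rintro rfl; norm_num at hd4
  haveI : NeZero d.natAbs := ⟨Int.natAbs_ne_zero.mpr hd0⟩
  have hB := (W.rootNumber_quadraticTwist_of_emod_four_eq_one hmod hd4 hdsq hgcd).1
  -- `(N / |d|) = (M/|d|)·(p/|d|)² = 1`
  have hgcdp : Int.gcd (p : ℤ) d.natAbs = 1 := by
    rw [Int.gcd_natCast_natCast]
    have h1 : Nat.Coprime d.natAbs (W.conductorNorm ℤ) := by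
      have := hgcd; unfold Int.gcd at this; simpa using this
    have hpN : p ∣ W.conductorNorm ℤ := by rw [hN]; exact ⟨M * p, by ring⟩
    exact (Nat.Coprime.coprime_dvd_right hpN h1).symm
  have hJN : J((W.conductorNorm ℤ : ℤ) | d.natAbs) = 1 := by
    rw [hN, Nat.cast_mul, jacobiSym.mul_left, jacobiSym_natCast_natAbs_eq_one_of_split hd4 hM0 hodd htwo, Nat.cast_pow,
      jacobiSym.sq_one' hgcdp, mul_one]
  have hJ1 := jacobiSym_neg_one_natAbs_eq_neg_one_of_neg hd4 hneg
  have hw2 : W.rootNumber * W.rootNumber = 1 := by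
    rcases W.rootNumber_eq_one_or with h | h <;> rw [h] <;> norm_num
  rw [hB, hJ1, hJN]
  linear_combination (-1 : ℤ) * hw2

/-- **FIELD FORM: an imaginary quadratic `K′` with `d_{K′}` odd, `p` UNRAMIFIED (`p ∤ d_{K′}`) and every prime of `M` split has
`w(E)·w(E^{(d_{K′})}) = −1`** (`N_E = M p²`; Modularity only). The ramified habitat of the card is exactly what escapes this.
[cite: MurtyMurty1997, Ch. 6 §1] [cite: SilvermanAEC2009, X.2 and App. C §16] -/
theorem rootNumber_mul_rootNumber_twist_discr_eq_neg_one_of_unramified (W : WeierstrassCurve ℚ) [W.IsElliptic] (hmod : exists_isNewformOf)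
    {M : ℕ} (hN : W.conductorNorm ℤ = M * p ^ 2)
    (K : Type) [Field K] [NumberField K] (hK : IsImaginaryQuadratic K) (hKodd : Odd (NumberField.discr K))
    (hpd : ¬ (p : ℤ) ∣ NumberField.discr K)
    (hodd : ∀ q ∈ M.primeFactors, q ≠ 2 → J(NumberField.discr K | q) = 1)
    (htwo : 2 ∣ M → NumberField.discr K % 8 = 1) :
    W.rootNumber * (W.quadraticTwist (NumberField.discr K : ℚ)).rootNumber = -1 := by
  have hp : p.Prime := Fact.out
  have hM0 : M ≠ 0 := by
    intro h; rw [h, zero_mul] at hN; exact (W.conductorNorm_pos_holds).ne' hN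
  set d := NumberField.discr K with hd
  -- `d` is an odd fundamental discriminant: `d ≡ 1 (4)`, squarefree, negative
  obtain ⟨hd4, hdsq⟩ : d % 4 = 1 ∧ Squarefree d := by
    rcases Literature.NumberTheory.QuadraticFields.Quadratic.isFundamentalDiscriminant_discr (K := K) hK.1 with
      ⟨h4, hsq, -⟩ | ⟨h4, -, -⟩
    · exact ⟨h4, hsq⟩
    · exfalso
      obtain ⟨k, hk⟩ := h4
      obtain ⟨m, hm⟩ := hKodd
      omega
  have hdneg : d < 0 := IsImaginaryQuadratic.discr_neg hK
  -- `(d, N) = 1`: the primes of `M` split, `p ∤ d`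
  have hgcd : Int.gcd d (W.conductorNorm ℤ) = 1 := by
    rw [← Int.isCoprime_iff_gcd_eq_one, hN]
    push_cast
    refine IsCoprime.mul_right ?_ (IsCoprime.pow_right ?_)
    · have hMprod : (M : ℤ) = ∏ q ∈ M.primeFactors, (q : ℤ) ^ M.factorization q := by
        conv_lhs => rw [Nat.prod_primeFactors_pow_factorization hM0]
        push_cast
        rfl
      rw [hMprod]
      refine IsCoprime.prod_right fun q hq ↦ IsCoprime.pow_right ?_
      have hqp : q.Prime := Nat.prime_of_mem_primeFactors hq
      have hqZ : Prime (q : ℤ) := Nat.prime_iff_prime_int.mp hqp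
      refine (Prime.coprime_iff_not_dvd hqZ).mpr (fun hqd ↦ ?_) |>.symm
      by_cases hq2 : q = 2
      · subst hq2
        obtain ⟨m, hm⟩ := hKodd
        obtain ⟨c, hc⟩ := hqd
        omega
      · haveI : NeZero q := ⟨hqp.ne_zero⟩
        have hJ := hodd q hq hq2
        have h0 : J(d | q) = 0 := jacobiSym.eq_zero_iff_not_coprime.mpr (by
          intro hc
          have hc' : IsCoprime d (q : ℤ) := Int.isCoprime_iff_gcd_eq_one.mpr hc
          exact hqZ.not_unit (hc'.isUnit_of_dvd' hqd (dvd_refl _)))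
        rw [h0] at hJ
        exact zero_ne_one hJ
    · exact ((Prime.coprime_iff_not_dvd (Nat.prime_iff_prime_int.mp hp)).mpr hpd).symm
  exact rootNumber_mul_rootNumber_twist_eq_neg_one_of_unramified W hmod hN hd4 hdsq hdneg hgcd hodd htwo

end Unramified

end Summit.BirchSwinnertonDyer.BirchSwinnertonDyer.Theorems.AdditiveKoly.RamifiedHabitat

end
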